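import Summits.QuantumFields.BalabanUV.T4Continuum.Support.NE3TangentNoGoWords
import Summits.QuantumFields.BalabanUV.T4Continuum.Support.BlockAveragePushDirSplit
import Summits.QuantumFields.BalabanUV.T4Continuum.Support.AveragingDeficitMultiLevelPrep
import Summits.QuantumFields.BalabanUV.T4Continuum.Support.SmoothRefineNeutral
import Mathlib.RingTheory.RootsOfUnity.Complex
import HarnessLib

/-!
# T⁴ programme, node NE3 — NO-GO for k-uniform tangent coercivity in the unit-scale energy norm, part 2:
# the WAVE WITNESS lies in the k-FOLD tangent space `TangentIter L (k−1) 1 ·` at the flat background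

NE3 prover lineage P1, gen 19 (cell `pub-balaban`, unit `b2b-balaban-t4-ne3-p1`, row NE3 OWNER); located error G-ne3p1-g19-1.
At the flat background the differential of the block average (42) is Bałaban's contour average `Tside` ((47);
`BlockAveragePushDirSplit.pushDir_flat`), so the k-fold tangent space `AveragingDeficitMultiLevelPrep.TangentIter L (k−1) flat`
of route P2's root is the kernel of the k-th iterate of `SmoothRefineNeutral.Tcoarse L`.  For the two-parameter family of
CENTRAL (`U(1)·1 ⊂ 𝔲(n)`) directions
  `wave i₀ i₁ θ ρ τ := prof i₀ i₁ (t ↦ cen (Re(ρ e^{2πiθt}))) + dPot (x ↦ cen (Re(τ e^{2πiθ x_{i₁}})))`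
(a plane wave of frequency `θ` on the bonds of direction `i₀ = 0`, profile along `x_{i₁}`, plus an exact term) part 1 gives
`Tcoarse L (wave θ ρ τ) = wave (Lθ) (ρ·σ_L(θ)) (τ − ((L−1)/(2L))·ρ·σ_L(θ))`, `σ_L(θ) = Σ_{t<L} e^{2πiθt}` (§3): the family is
CLOSED under the contour average, the frequency is multiplied by `L`.  Starting from `θ = L^{−k}`: after `k − 1` steps the
frequency is `1/L` and `σ_L(1/L) = 0` (sum of the `L`-th roots of unity), after `k` steps the frequency is an integer and every
wave is constant — the k-th iterate VANISHES (§4), i.e. **`wave (L^{−k}) ρ τ ∈ TangentIter L (k−1) flat`** (§5) although for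
k ≥ 2 it is NOT in the one-step kernel: a genuinely k-fold tangent vector varying on the scale `L^k` of the coarsest constraint.

CONTENT (3 defs = `cen`, `cwave`, `wave`; 0 sorry): §1 `cen`, additivity∕homogeneity of `asum`∕`Tside`; §2 plane waves `cwave`,
their block sums (`bsum_cwave`), subsampling, integer frequencies, `sigma_one_div_eq_zero`; §3 the one-step law `Tcoarse_wave`;
§4 `iterate_Tcoarse_wave`, `iterate_Tcoarse_wave_eq_zero`; §5 `tangentIter_flat_of_iterate`, **`tangentIter_wave`**.

HONEST FRAMING.  Lattice kinematics at the FLAT configuration only (our frame); nothing about minimisers, T-E, (H∃) or NE3 is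
asserted; NE3 NOT proved; spine 0∕9; finite T⁴ rung (B)+1 — NOT infinite volume, NOT mass gap, NOT Clay.
PLACEMENT: `Summits/QuantumFields/BalabanUV/`.
-/

set_option autoImplicit false

open scoped BigOperators Matrix.Norms.L2Operator
open Finset

namespace Summit.QuantumFields.BalabanUV.T4Continuum.NE3TangentNoGoFlat

open Literature.MathematicalPhysics.QuantumFieldTheory.Balaban1983to89
open B7Prop1Explicit B7Prop2Explicit
open AveragingDeficitMultiLevelPrep (TangentIter cpush)
open AveragingDeficitChartCalculus (cavg)
open BlockAveragePushDirSplit (flat pushDir_flat)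
open SmoothRefineNeutral (Tcoarse)
open NE3TangentNoGoWords

noncomputable section

variable {d : ℕ} {n : Type*} [Fintype n] [DecidableEq n]

/-! ## §1 Central values; additivity of the contour functionals -/

/-- The central skew element `cen r = (r·i)·1 ∈ 𝔲(n)` (`r` real). [folklore] -/
def cen (r : ℝ) : Matrix n n ℂ := ((r : ℂ) * Complex.I) • (1 : Matrix n n ℂ)

omit [Fintype n] in
/-- `cen` is additive. [folklore] -/
theorem cen_add (a b : ℝ) : (cen (a + b) : Matrix n n ℂ) = cen a + cen b := by
  simp [cen, add_mul, add_smul]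

omit [Fintype n] in
/-- `cen` is `ℝ`-homogeneous. [folklore] -/
theorem cen_mul (a b : ℝ) : (cen (a * b) : Matrix n n ℂ) = a • cen b := by
  simp only [cen, Complex.ofReal_mul, ← Complex.coe_smul, smul_smul, mul_assoc]

omit [Fintype n] in
/-- `cen 0 = 0`. [folklore] -/
@[simp] theorem cen_zero : (cen 0 : Matrix n n ℂ) = 0 := by simp [cen]

omit [Fintype n] in
/-- `cen` of a difference. [folklore] -/
theorem cen_sub (a b : ℝ) : (cen (a - b) : Matrix n n ℂ) = cen a - cen b := by
  simp [cen, sub_mul, sub_smul]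

omit [Fintype n] in
/-- `cen` of a finite sum. [folklore] -/
theorem cen_sum {ι : Type*} (s : Finset ι) (f : ι → ℝ) : (cen (∑ i ∈ s, f i) : Matrix n n ℂ) = ∑ i ∈ s, cen (f i) := by
  simp [cen, Finset.sum_mul, Finset.sum_smul]

section Additive

variable {𝔸 : Type*} [NormedRing 𝔸] [NormedAlgebra ℂ 𝔸]

omit [NormedAlgebra ℂ 𝔸] in
/-- `asum` is additive in the cochain. [folklore] -/
theorem asum_add' (A B : Site d → Fin d → 𝔸) :
    ∀ (x : Site d) (w : List (Letter d)), asum (fun y μ => A y μ + B y μ) x w = asum A x w + asum B x w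
  | x, [] => by simp
  | x, l :: w => by
      rw [asum_cons, asum_cons, asum_cons, asum_add' A B (x + l.vec) w]
      obtain ⟨μ, b⟩ := l
      cases b <;> simp only [stepA, Bool.false_eq_true, ↓reduceIte] <;> abel

/-- `Tside` is additive in the cochain. [folklore] -/
theorem Tside_add' (L : ℕ) (A B : Site d → Fin d → 𝔸) (q : Site d) (κ : Fin d) :
    Tside L (fun y μ => A y μ + B y μ) q κ = Tside L A q κ + Tside L B q κ := by
  unfold Tside
  rw [← sum_add_distrib]
  exact sum_congr rfl fun r _ => by rw [asum_add', smul_add]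

end Additive

/-! ## §2 Plane waves along the profile coordinate -/

/-- THE PLANE WAVE of frequency `θ` and complex amplitude `ρ`: `w ↦ Re(ρ·e^{2πiθw})`. [folklore] -/
def cwave (θ : ℝ) (ρ : ℂ) (w : ℤ) : ℝ := (ρ * Complex.exp (2 * Real.pi * Complex.I * θ * w)).re

/-- The one-block sum of phases `σ_L(θ) = Σ_{t<L} e^{2πiθt}`. [folklore] -/
def sigma (L : ℕ) (θ : ℝ) : ℂ := ∑ t : Fin L, Complex.exp (2 * Real.pi * Complex.I * θ * (t : ℕ))

/-- `cwave` is `ℝ`-linear in the amplitude: real multiples. [folklore] -/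
theorem cwave_ofReal_mul (θ c : ℝ) (ρ : ℂ) (w : ℤ) : cwave θ ((c : ℂ) * ρ) w = c * cwave θ ρ w := by
  simp [cwave, mul_assoc]

/-- … and differences. [folklore] -/
theorem cwave_sub (θ : ℝ) (ρ τ : ℂ) (w : ℤ) : cwave θ (ρ - τ) w = cwave θ ρ w - cwave θ τ w := by
  simp [cwave, sub_mul]

/-- Zero amplitude. [folklore] -/
@[simp] theorem cwave_zero (θ : ℝ) (w : ℤ) : cwave θ 0 w = 0 := by simp [cwave]

/-- Unit amplitude is the cosine wave. [folklore] -/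
theorem cwave_one (θ : ℝ) (w : ℤ) : cwave θ 1 w = Real.cos (2 * Real.pi * θ * w) := by
  rw [cwave, one_mul, show (2 * Real.pi * Complex.I * θ * w : ℂ) = ((2 * Real.pi * θ * w : ℝ) : ℂ) * Complex.I by
    push_cast; ring, Complex.exp_ofReal_mul_I_re]

/-- **BLOCK SUMS OF A WAVE**: `Σ_{t<L} Re(ρ e^{2πiθ(Lw+t)}) = Re(ρ·σ_L(θ)·e^{2πi(Lθ)w})` — a wave of frequency `Lθ` and
amplitude `ρ·σ_L(θ)`. [folklore] -/
theorem bsum_cwave (L : ℕ) (θ : ℝ) (ρ : ℂ) (w : ℤ) :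
    ∑ t : Fin L, cwave θ ρ ((L : ℤ) * w + (t : ℕ)) = cwave (L * θ) (ρ * sigma L θ) w := by
  unfold cwave sigma
  rw [← Complex.re_sum]
  congr 1
  rw [mul_sum, sum_mul]
  refine sum_congr rfl fun t _ => ?_
  simp only [mul_assoc, ← Complex.exp_add]
  congr 2
  push_cast
  ring

/-- SUBSAMPLING: `Re(τ e^{2πiθ(Lw)}) = Re(τ e^{2πi(Lθ)w})`. [folklore] -/
theorem cwave_mul_left (L : ℕ) (θ : ℝ) (τ : ℂ) (w : ℤ) : cwave θ τ ((L : ℤ) * w) = cwave (L * θ) τ w := by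
  unfold cwave
  congr 3
  push_cast
  ring

/-- INTEGER FREQUENCY: the wave is CONSTANT, `Re(ρ e^{2πi m w}) = Re ρ`. [folklore] -/
theorem cwave_intCast (m : ℤ) (ρ : ℂ) (w : ℤ) : cwave (m : ℝ) ρ w = ρ.re := by
  unfold cwave
  rw [show (2 * Real.pi * Complex.I * ((m : ℝ) : ℂ) * (w : ℂ)) = ((m * w : ℤ) : ℂ) * (2 * Real.pi * Complex.I) by
    push_cast; ring, Complex.exp_int_mul_two_pi_mul_I, mul_one]

/-- **THE LAST STEP KILLS THE WAVE**: `σ_L(1/L) = Σ_{t<L} e^{2πit/L} = 0` for `L ≥ 2` (sum of all `L`-th roots of unity).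
[folklore] -/
theorem sigma_one_div_eq_zero {L : ℕ} (hL : 2 ≤ L) : sigma L (1 / (L : ℝ)) = 0 := by
  have hL0 : L ≠ 0 := by omega
  have hprim := Complex.isPrimitiveRoot_exp L hL0
  have hgeom := hprim.geom_sum_eq_zero (by omega : 1 < L)
  unfold sigma
  rw [Fin.sum_univ_eq_sum_range (fun t => Complex.exp (2 * Real.pi * Complex.I * ((1 / (L : ℝ) : ℝ) : ℂ) * (t : ℕ))) L]
  rw [← hgeom]
  refine sum_congr rfl fun t _ => ?_
  rw [← Complex.exp_nat_mul]
  congr 1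
  push_cast
  field_simp

/-! ## §3 The wave family and its one-step law under the contour average -/

variable (i₀ i₁ : Fin d)

/-- THE WAVE WITNESS FAMILY: profile wave (amplitude `ρ`) on the `i₀`-bonds + exact term with potential wave (amplitude `τ`),
both central-valued, frequency `θ` along `x_{i₁}`. [folklore] -/
def wave (θ : ℝ) (ρ τ : ℂ) : Site d → Fin d → Matrix n n ℂ := fun x μ =>
  prof i₀ i₁ (fun t => cen (cwave θ ρ t)) x μ + dPot (fun y : Site d => (cen (cwave θ τ (y i₁)) : Matrix n n ℂ)) x μ

variable {i₀ i₁}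

omit [Fintype n] [DecidableEq n] in
/-- Moving along `e_κ`, `κ ≠ i₁`, does not change the profile coordinate. [folklore] -/
theorem coord_add_e_of_ne {κ : Fin d} (hκ : κ ≠ i₁) (x : Site d) : (x + e κ) i₁ = x i₁ := by
  simp [e_apply, Ne.symm hκ]

/-- The wave at a bond of the support direction: the profile value. [folklore] -/
theorem wave_apply_self (h01 : i₀ ≠ i₁) (θ : ℝ) (ρ τ : ℂ) (x : Site d) :
    wave (n := n) i₀ i₁ θ ρ τ x i₀ = cen (cwave θ ρ (x i₁)) := by
  simp [wave, prof, dPot, coord_add_e_of_ne h01]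

/-- The wave at a bond of the profile direction: the exact term only. [folklore] -/
theorem wave_apply_profileDir (h01 : i₀ ≠ i₁) (θ : ℝ) (ρ τ : ℂ) (x : Site d) :
    wave (n := n) i₀ i₁ θ ρ τ x i₁ = cen (cwave θ τ (x i₁ + 1)) - cen (cwave θ τ (x i₁)) := by
  have h10 : i₁ ≠ i₀ := fun h => h01 h.symm
  simp [wave, prof, dPot, h10, e_apply]

/-- The wave vanishes on all other bonds. [folklore] -/
theorem wave_apply_other (θ : ℝ) (ρ τ : ℂ) (x : Site d) {κ : Fin d} (hκ0 : κ ≠ i₀) (hκ1 : κ ≠ i₁) :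
    wave (n := n) i₀ i₁ θ ρ τ x κ = 0 := by
  simp [wave, prof, dPot, hκ0, coord_add_e_of_ne hκ1]

/-- Block sums of the central profile wave. [folklore] -/
theorem bsum_cen_cwave (L : ℕ) (θ : ℝ) (ρ : ℂ) (w : ℤ) :
    bsum L (fun t => (cen (cwave θ ρ t) : Matrix n n ℂ)) w = cen (cwave (L * θ) (ρ * sigma L θ) w) := by
  unfold bsum
  rw [← cen_sum, bsum_cwave]

/-- **THE ONE-STEP LAW** (`d = m + 2 ≥ 2`, `(i₀ : ℕ) = 0`, `i₀ ≠ i₁`, `L ≥ 1`): the contour average maps the wave of frequency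
`θ` and amplitudes `(ρ, τ)` to the wave of frequency `Lθ` and amplitudes `(ρσ, τ − ((L−1)/(2L))·ρσ)`, `σ = σ_L(θ)`. [folklore] -/
theorem Tcoarse_wave {m : ℕ} {i₀ i₁ : Fin (m + 2)} (h0 : (i₀ : ℕ) = 0) (h01 : i₀ ≠ i₁) (L : ℕ) (hL : 1 ≤ L) (θ : ℝ)
    (ρ τ : ℂ) :
    Tcoarse L (wave (n := n) i₀ i₁ θ ρ τ)
      = wave i₀ i₁ (L * θ) (ρ * sigma L θ) (τ - (((((L : ℝ) - 1) / (2 * L)) : ℝ) : ℂ) * (ρ * sigma L θ)) := by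
  have h10 : i₁ ≠ i₀ := fun h => h01 h.symm
  set c : ℝ := ((L : ℝ) - 1) / (2 * L) with hc
  funext z κ
  show Tside L (wave i₀ i₁ θ ρ τ) ((L : ℤ) • z) κ = _
  unfold wave
  rw [Tside_add', Tside_dPot L hL]
  have hLz : ((L : ℤ) • z) i₁ = (L : ℤ) * z i₁ := by simp
  by_cases hκ0 : κ = i₀
  · subst hκ0
    rw [Tside_prof_self (m := m + 1) h0 h01 L hL, bsum_cen_cwave, coord_add_zsmul_e_of_ne h01, sub_self, add_zero]
    simp [prof, dPot, e_apply, h10]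
  · by_cases hκ1 : κ = i₁
    · subst hκ1
      rw [Tside_prof_profileDir h0 h01 L hL, bsum_cen_cwave, bsum_cen_cwave, hLz]
      have hc2 : ((L : ℤ) • z + (L : ℤ) • e κ) κ = (L : ℤ) * (z κ + 1) := by simp [e_apply]; ring
      rw [hc2, cwave_mul_left, cwave_mul_left, ← hc]
      simp only [prof, dPot, if_neg h10, zero_add, Pi.add_apply, e_apply, if_true, cwave_sub, cwave_ofReal_mul,
        cen_sub, cen_mul]
      module
    · rw [Tside_prof_other h0 h01 L _ z hκ0 hκ1, zero_add, coord_add_zsmul_e_of_ne (Ne.symm ?_) _ _, sub_self]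
      · simp [prof, dPot, hκ0, e_apply, Ne.symm hκ1]
      · exact fun h => hκ1 h.symm

/-! ## §4 Iteration: after k steps the wave of frequency `L^{−k}` is gone -/

/-- After `j` contour averages a wave of frequency `θ` is a wave of frequency `L^j θ` (some amplitudes). [folklore] -/
theorem iterate_Tcoarse_wave {m : ℕ} {i₀ i₁ : Fin (m + 2)} (h0 : (i₀ : ℕ) = 0) (h01 : i₀ ≠ i₁) (L : ℕ) (hL : 1 ≤ L)
    (θ : ℝ) (ρ τ : ℂ) (j : ℕ) :
    ∃ ρ' τ' : ℂ, (Tcoarse L)^[j] (wave (n := n) i₀ i₁ θ ρ τ) = wave i₀ i₁ ((L : ℝ) ^ j * θ) ρ' τ' := by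
  induction j with
  | zero => exact ⟨ρ, τ, by simp⟩
  | succ j ih =>
      obtain ⟨ρ', τ', h⟩ := ih
      refine ⟨ρ' * sigma L ((L : ℝ) ^ j * θ), τ' - (((((L : ℝ) - 1) / (2 * L)) : ℝ) : ℂ) * (ρ' * sigma L ((L : ℝ) ^ j * θ)), ?_⟩
      rw [Function.iterate_succ_apply', h, Tcoarse_wave h0 h01 L hL, pow_succ]
      ring_nf

/-- A wave of INTEGER frequency with ZERO profile amplitude is the zero direction (the exact term of a constant potential
vanishes). [folklore] -/
theorem wave_intCast_zero (mm : ℤ) (τ : ℂ) : wave (n := n) i₀ i₁ (mm : ℝ) 0 τ = 0 := by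
  funext x μ
  simp [wave, prof, dPot, cwave_intCast]

/-- **THE k-TH ITERATE VANISHES**: `(Tcoarse L)^[k] (wave L^{−k} ρ τ) = 0` (`k ≥ 1`, `L ≥ 2`): the `(k−1)`-th iterate has
frequency `1/L`, whose block phase sum `σ_L(1/L)` vanishes, and the `k`-th has integer frequency. [folklore] -/
theorem iterate_Tcoarse_wave_eq_zero {m : ℕ} {i₀ i₁ : Fin (m + 2)} (h0 : (i₀ : ℕ) = 0) (h01 : i₀ ≠ i₁) {L : ℕ}
    (hL : 2 ≤ L) {k : ℕ} (hk : 1 ≤ k) (ρ τ : ℂ) :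
    (Tcoarse L)^[k] (wave (n := n) i₀ i₁ (1 / (L : ℝ) ^ k) ρ τ) = 0 := by
  have hL1 : 1 ≤ L := le_trans (by norm_num) hL
  have hL0 : (L : ℝ) ≠ 0 := by exact_mod_cast (by omega : L ≠ 0)
  obtain ⟨j, rfl⟩ : ∃ j, k = j + 1 := ⟨k - 1, by omega⟩
  obtain ⟨ρ', τ', h⟩ := iterate_Tcoarse_wave (n := n) h0 h01 L hL1 (1 / (L : ℝ) ^ (j + 1)) ρ τ j
  have hfreq : (L : ℝ) ^ j * (1 / (L : ℝ) ^ (j + 1)) = 1 / (L : ℝ) := by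
    rw [pow_succ]; field_simp
  rw [Function.iterate_succ_apply', h, hfreq, Tcoarse_wave h0 h01 L hL1, sigma_one_div_eq_zero hL, mul_zero,
    show ((L : ℝ) * (1 / (L : ℝ))) = ((1 : ℤ) : ℝ) by push_cast; field_simp]
  exact wave_intCast_zero 1 _

/-! ## §5 The k-fold tangent space at the flat background -/

/-- At the flat background the coarse push-forward of (42) IS the contour average read on the coarse lattice:
`cpush L 1 Y = Tcoarse L Y`. [folklore] -/
theorem cpush_flat (L : ℕ) (hL : 1 ≤ L) (Y : Site d → Fin d → Matrix n n ℂ) :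
    cpush L (flat (d := d) (n := n)) Y = Tcoarse L Y := by
  funext z κ
  show AveragingDeficitResidualPairing.pushDir L flat Y ((L : ℤ) • z) κ = Tside L Y ((L : ℤ) • z) κ
  exact pushDir_flat L hL Y _ κ

/-- The flat background is its own block average read on the coarse lattice: `cavg L 1 = 1`. [folklore] -/
theorem cavg_flat (L : ℕ) : cavg L (flat (d := d) (n := n)) = flat := by
  funext y κ
  show bavg L (fun (_ : Site d) (_ : Fin d) => (1 : (Matrix n n ℂ)ˣ)) ((L : ℤ) • y) κ = 1
  rw [T4AveragingDeficitWall.bavg_flat]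

/-- **THE k-FOLD TANGENT SPACE AT THE FLAT BACKGROUND IS THE KERNEL OF THE (k)-TH ITERATED CONTOUR AVERAGE**:
`(Tcoarse L)^[j+1] Y = 0 ⟹ TangentIter L j 1 Y`. [folklore] -/
theorem tangentIter_flat_of_iterate (L : ℕ) (hL : 1 ≤ L) :
    ∀ (j : ℕ) (Y : Site d → Fin d → Matrix n n ℂ), (Tcoarse L)^[j + 1] Y = 0 → TangentIter L j (flat (d := d) (n := n)) Y
  | 0, Y, h => by
      show cpush L flat Y = 0
      rw [cpush_flat L hL]
      simpa using h
  | j + 1, Y, h => by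
      show TangentIter L j (cavg L flat) (cpush L flat Y)
      rw [cavg_flat, cpush_flat L hL]
      refine tangentIter_flat_of_iterate L hL j _ ?_
      rw [← Function.iterate_succ_apply]
      exact h

/-- **THE WAVE WITNESS IS A k-FOLD TANGENT VECTOR AT THE FLAT BACKGROUND**: for `d ≥ 2` (`i₀ = 0 ≠ i₁`), `L ≥ 2`, `k ≥ 1`
and all amplitudes, `TangentIter L (k−1) 1 (wave L^{−k} ρ τ)`. [folklore] -/
theorem tangentIter_wave {m : ℕ} {i₀ i₁ : Fin (m + 2)} (h0 : (i₀ : ℕ) = 0) (h01 : i₀ ≠ i₁) {L : ℕ} (hL : 2 ≤ L) {k : ℕ}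
    (hk : 1 ≤ k) (ρ τ : ℂ) :
    TangentIter L (k - 1) (flat (d := m + 2) (n := n)) (wave (n := n) i₀ i₁ (1 / (L : ℝ) ^ k) ρ τ) := by
  have hL1 : 1 ≤ L := le_trans (by norm_num) hL
  refine tangentIter_flat_of_iterate L hL1 (k - 1) _ ?_
  rw [Nat.sub_add_cancel hk]
  exact iterate_Tcoarse_wave_eq_zero h0 h01 hL hk ρ τ

end

end Summit.QuantumFields.BalabanUV.T4Continuum.NE3TangentNoGoFlat
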